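import Summits.Ventures.PercRepro.Night2LocalD2R14LargeFour

/-!
# PercRepro — THEOREM G: the columns of R1₄ at the shadow sets with `|S| ≥ 7` are at most `1` (night-2, gen 16)

At a shadow set `S` with `|S| ≥ 7` of the coloop cell (Case A: simple matroid, `G ∈ flatsQ M 5`, `|E ∖ G| = 2`, `y`
the coloop of `M|G`, `G ∖ y` without coloop) the column of the rule R1₄ (Night2LocalD2R14Defs) is
`(2/5)·ι + Σ_{CovPre} r14Cov + Σ_{PairPre} r14Pair` (no keep, no spread), with `ι = #IdPre ≤ 1`, `c = #CovPre ≤ 2`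
(`card_r14CovPre_le_two`), `p = #pairPre`, `f = #opFarPre ≤ p`, and the counting of the pair preimages
(Night2LocalD2R14Large / LargeCount / LargeCoColoop / LargeFour):
`f ≥ 2 ⟹ ι = c = 0` · `f ≥ 1 ⟹ p ≤ 3` · `c ≥ 1 ⟹ p ≤ 2` · `c ≥ 2 ⟹ p = 0` · `p ≤ |S| − 1` · `|S| ≥ 9 ⟹ p ≤ 3`.
The arithmetic `70ι + 30c + 35f + 14p ≤ 175` (`large_col_arith`) closes every case (worst `24/25` at `ι = 1`,
`c = f = 0`, `p = 7`, and `21/25` with three far preimages).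

**`sum_r14W_col_le_of_seven_le`** — THEOREM G.  With the basis columns (`sum_r14W_col_le_of_card_five`, `|S| = 5`)
only the columns at `|S| = 6` remain for the assembly `localShadowHall_of_r14W_columns`.
-/

namespace PercRepro.Shadow

open Finset PerFlat ThmH

variable {α : Type*} [DecidableEq α] {M : Matroid α} [M.Finite]

/-! ## At most two covering preimages with `m ≥ 2` -/

/-- A shadow set at the diagonal `(6, 4)` has rank `5`. -/
theorem rkN_eq_five_of_mem_shadowAt {G S : Finset α} (hS : S ∈ shadowAt M (4 + 2) 4 (Uq M (4 + 2) 4) G) :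
    rkN M S = 5 := by
  have h := eRk_eq_of_mem_Yq_diag (shadow_subset_Yq _ (mem_shadowAt.1 hS).1)
  unfold rkN
  rw [h]
  rfl

open scoped Classical in
/-- **At most two covering preimages with `|G ∖ cl B| ≥ 2`** at a shadow set with `|S| ≥ 7` (simple matroid): three
would be faces `S ∖ {zᵢ}` at three coloops `zᵢ ≠ y` of `S`, leaving `S ∖ {y, z₁, z₂, z₃}` of rank `1`. -/
theorem card_r14CovPre_le_two {G : Finset α} (hG : G ∈ flatsQ M (4 + 1))
    (hsimple : ∀ e ∈ gr M, ∀ f ∈ gr M, e ≠ f → rkN M {e, f} = 2) {y : α} (hyG : y ∈ G)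
    (hyc : y ∉ clF M (G.erase y)) {S : Finset α} (hS : S ∈ shadowAt M (4 + 2) 4 (Uq M (4 + 2) 4) G)
    (h7 : 7 ≤ S.card) : (r14CovPre M G S).card ≤ 2 := by
  have hGg : G ⊆ gr M := (mem_flatsQ.1 hG).1
  have hSG : S ⊆ G := subset_of_mem_shadowAt hS
  have hyS : y ∈ S := mem_of_mem_shadowAt_of_coloop (by rw [rkN_erase_eq_of_coloop hG hyG hyc]) hS
  by_contra hcon
  push Not at hcon
  rw [Finset.two_lt_card_iff] at hcon
  obtain ⟨B₁, B₂, B₃, hB₁, hB₂, hB₃, h₁₂, h₁₃, h₂₃⟩ := hcon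
  obtain ⟨z₁, hz₁S, hz₁y, rfl, hz₁, -⟩ := exists_coloop_of_mem_r14CovPre hG hyG hyc hB₁
  obtain ⟨z₂, hz₂S, hz₂y, rfl, hz₂, -⟩ := exists_coloop_of_mem_r14CovPre hG hyG hyc hB₂
  obtain ⟨z₃, hz₃S, hz₃y, rfl, hz₃, -⟩ := exists_coloop_of_mem_r14CovPre hG hyG hyc hB₃
  have hz₁₂ : z₁ ≠ z₂ := fun h => h₁₂ (by rw [h])
  have hz₁₃ : z₁ ≠ z₃ := fun h => h₁₃ (by rw [h])
  have hz₂₃ : z₂ ≠ z₃ := fun h => h₂₃ (by rw [h])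
  set T := S \ {y, z₁, z₂, z₃} with hTdef
  have hT₃ : T ⊆ S.erase z₃ := by
    intro e he
    rw [hTdef, Finset.mem_sdiff] at he
    simp only [Finset.mem_insert, Finset.mem_singleton, not_or] at he
    exact Finset.mem_erase.2 ⟨he.2.2.2.2, he.1⟩
  have h3 := rkN_insert_coloop_eq (hSG.trans hGg) hz₃S hz₃ hT₃
  have hT₂ : insert z₃ T ⊆ S.erase z₂ := by
    intro e he
    rw [Finset.mem_insert] at he
    rcases he with rfl | he
    · exact Finset.mem_erase.2 ⟨hz₂₃.symm, hz₃S⟩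
    · rw [hTdef, Finset.mem_sdiff] at he
      simp only [Finset.mem_insert, Finset.mem_singleton, not_or] at he
      exact Finset.mem_erase.2 ⟨he.2.2.2.1, he.1⟩
  have h2 := rkN_insert_coloop_eq (hSG.trans hGg) hz₂S hz₂ hT₂
  have hT₁ : insert z₂ (insert z₃ T) ⊆ S.erase z₁ := by
    intro e he
    rw [Finset.mem_insert, Finset.mem_insert] at he
    rcases he with rfl | rfl | he
    · exact Finset.mem_erase.2 ⟨hz₁₂.symm, hz₂S⟩
    · exact Finset.mem_erase.2 ⟨hz₁₃.symm, hz₃S⟩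
    · rw [hTdef, Finset.mem_sdiff] at he
      simp only [Finset.mem_insert, Finset.mem_singleton, not_or] at he
      exact Finset.mem_erase.2 ⟨he.2.2.1, he.1⟩
  have h1 := rkN_insert_coloop_eq (hSG.trans hGg) hz₁S hz₁ hT₁
  have hTy : insert z₁ (insert z₂ (insert z₃ T)) ⊆ G.erase y := by
    intro e he
    rw [Finset.mem_insert, Finset.mem_insert, Finset.mem_insert] at he
    rcases he with rfl | rfl | rfl | he
    · exact Finset.mem_erase.2 ⟨hz₁y, hSG hz₁S⟩
    · exact Finset.mem_erase.2 ⟨hz₂y, hSG hz₂S⟩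
    · exact Finset.mem_erase.2 ⟨hz₃y, hSG hz₃S⟩
    · rw [hTdef, Finset.mem_sdiff] at he
      simp only [Finset.mem_insert, Finset.mem_singleton, not_or] at he
      exact Finset.mem_erase.2 ⟨he.2.1, hSG he.1⟩
  have h0 := rkN_insert_coloop_eq hGg hyG hyc hTy
  have hSeq : S = insert y (insert z₁ (insert z₂ (insert z₃ T))) := by
    ext e
    simp only [hTdef, Finset.mem_insert, Finset.mem_sdiff, Finset.mem_singleton, not_or]
    constructor
    · intro he
      by_cases hey : e = y
      · exact Or.inl hey
      by_cases he₁ : e = z₁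
      · exact Or.inr (Or.inl he₁)
      by_cases he₂ : e = z₂
      · exact Or.inr (Or.inr (Or.inl he₂))
      by_cases he₃ : e = z₃
      · exact Or.inr (Or.inr (Or.inr (Or.inl he₃)))
      exact Or.inr (Or.inr (Or.inr (Or.inr ⟨he, hey, he₁, he₂, he₃⟩)))
    · rintro (rfl | rfl | rfl | rfl | ⟨he, -⟩)
      · exact hyS
      · exact hz₁S
      · exact hz₂S
      · exact hz₃S
      · exact he
  have h5 : rkN M (insert y (insert z₁ (insert z₂ (insert z₃ T)))) = 5 := by
    rw [← hSeq]
    exact rkN_eq_five_of_mem_shadowAt hS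
  have hT1 : rkN M T ≤ 1 := by omega
  have hTg : T ⊆ gr M := by
    rw [hTdef]
    exact Finset.sdiff_subset.trans (hSG.trans hGg)
  have hTc := card_le_one_of_rkN_le_one hsimple hTg hT1
  have hSc : S.card ≤ T.card + 4 := by
    rw [hSeq]
    have := Finset.card_insert_le y (insert z₁ (insert z₂ (insert z₃ T)))
    have := Finset.card_insert_le z₁ (insert z₂ (insert z₃ T))
    have := Finset.card_insert_le z₂ (insert z₃ T)
    have := Finset.card_insert_le z₃ T
    omega
  omega

/-! ## The arithmetic -/

/-- The column arithmetic of THEOREM G: `70ι + 30c + 35f + 14p ≤ 175` under the counting facts. -/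
theorem large_col_arith_nat {ι c f p : ℕ} (hι : ι ≤ 1) (hc : c ≤ 2) (hfp : f ≤ p) (hp : p ≤ 7)
    (hK : 2 ≤ f → ι = 0 ∧ c = 0) (hF : 1 ≤ f → p ≤ 3) (hC1 : 1 ≤ c → p ≤ 2) (hC2 : 2 ≤ c → p = 0) :
    70 * ι + 30 * c + 35 * f + 14 * p ≤ 175 := by
  rcases Nat.lt_or_ge f 2 with hf2 | hf2
  · rcases Nat.lt_or_ge f 1 with hf1 | hf1
    · rcases Nat.lt_or_ge c 1 with hc1 | hc1
      · omega
      · have := hC1 hc1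
        rcases Nat.lt_or_ge c 2 with hc2 | hc2
        · omega
        · have := hC2 hc2
          omega
    · have := hF hf1
      rcases Nat.lt_or_ge c 1 with hc1 | hc1
      · omega
      · have := hC1 hc1
        rcases Nat.lt_or_ge c 2 with hc2 | hc2
        · omega
        · have := hC2 hc2
          omega
  · obtain ⟨h1, h2⟩ := hK hf2
    have := hF (by omega)
    omega

/-- The column arithmetic of THEOREM G over `ℚ`. -/
theorem large_col_arith {ι c f p : ℕ} (hι : ι ≤ 1) (hc : c ≤ 2) (hfp : f ≤ p) (hp : p ≤ 7)
    (hK : 2 ≤ f → ι = 0 ∧ c = 0) (hF : 1 ≤ f → p ≤ 3) (hC1 : 1 ≤ c → p ≤ 2) (hC2 : 2 ≤ c → p = 0) :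
    (ι : ℚ) * (2 / 5) + (c : ℚ) * (6 / 35) + ((f : ℚ) * (7 / 25) + ((p : ℚ) - (f : ℚ)) * (2 / 25)) ≤ 1 := by
  have h := large_col_arith_nat hι hc hfp hp hK hF hC1 hC2
  have h' : ((70 * ι + 30 * c + 35 * f + 14 * p : ℕ) : ℚ) ≤ 175 := by exact_mod_cast h
  push_cast at h'
  linarith

/-! ## THEOREM G -/

open scoped Classical in
/-- **THEOREM G: the column of R1₄ at a shadow set with `|S| ≥ 7` of the coloop cell (Case A) is at most `1`.** -/
theorem sum_r14W_col_le_of_seven_le {G : Finset α} (hG : G ∈ flatsQ M (4 + 1)) (hd : (gr M \ G).card = 2)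
    (hsimple : ∀ e ∈ gr M, ∀ f ∈ gr M, e ≠ f → rkN M {e, f} = 2) {y : α} (hyG : y ∈ G)
    (hyc : y ∉ clF M (G.erase y)) (hP : ∀ z ∈ G.erase y, 4 ≤ rkN M ((G.erase y).erase z)) {S : Finset α}
    (hS : S ∈ shadowAt M (4 + 2) 4 (Uq M (4 + 2) 4) G) (h7 : 7 ≤ S.card) :
    ∑ B ∈ membersIn M (Uq M (4 + 2) 4) G, r14W M G B S ≤ 1 := by
  have hparts := sum_r14W_col_le_parts (M := M) G S
  rw [r14KeepPre_eq_empty (by omega), Finset.sum_empty, r14Spread_eq_zero (by omega), add_zero, add_zero] at hparts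
  -- the covering part
  have hcov : ∑ B ∈ r14CovPre M G S, r14Cov M G B ≤ ((r14CovPre M G S).card : ℚ) * (6 / 35) := by
    rw [← nsmul_eq_mul, ← Finset.sum_const]
    exact Finset.sum_le_sum (fun B _ => r14Cov_le G B)
  -- the pair part
  have hpair := sum_r14Pair_le (M := M) G S
  rw [r14PairPre_eq_pairPre] at hparts
  -- the counts
  have hι := card_r14IdPre_le_one hG hyG hyc hP hS
  have hc := card_r14CovPre_le_two hG hsimple hyG hyc hS h7
  have hfp : (opFarPre M G S).card ≤ (pairPre M 4 G S).card :=
    Finset.card_le_card (opFarPre_subset_pairPre G S)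
  have hp : (pairPre M 4 G S).card ≤ 7 := by
    rcases Nat.lt_or_ge S.card 9 with h8 | h9
    · have := card_pairPre_add_one_le_card hG hsimple hyG hyc hS h7
      omega
    · have := card_pairPre_le_three_of_nine_le hG hsimple hyG hyc hS h9
      omega
  have hK : 2 ≤ (opFarPre M G S).card → (r14IdPre M G S).card = 0 ∧ (r14CovPre M G S).card = 0 := by
    intro h2
    rw [r14IdPre_eq_empty_of_two_far hG hd h2, r14CovPre_eq_empty_of_two_far hG hd h2]
    exact ⟨rfl, rfl⟩
  have hF : 1 ≤ (opFarPre M G S).card → (pairPre M 4 G S).card ≤ 3 := by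
    intro h1
    obtain ⟨B₀, hB₀⟩ := Finset.card_pos.1 (show 0 < (opFarPre M G S).card by omega)
    exact card_pairPre_le_three_of_far hG hd hsimple hyG hyc hS h7 hB₀
  have hC1 : 1 ≤ (r14CovPre M G S).card → (pairPre M 4 G S).card ≤ 2 := by
    intro h1
    obtain ⟨B₁, hB₁⟩ := Finset.card_pos.1 (show 0 < (r14CovPre M G S).card by omega)
    exact card_pairPre_le_two_of_covPre hG hsimple hyG hyc hS h7 hB₁
  have hC2 : 2 ≤ (r14CovPre M G S).card → (pairPre M 4 G S).card = 0 := by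
    intro h2
    obtain ⟨B₁, B₂, hB₁, hB₂, hne⟩ := Finset.one_lt_card_iff.1 (show 1 < (r14CovPre M G S).card by omega)
    rw [pairPre_eq_empty_of_two_covPre hG hsimple hyG hyc hS h7 hB₁ hB₂ hne]
    rfl
  have harith := large_col_arith hι hc hfp hp hK hF hC1 hC2
  linarith

end PercRepro.Shadow
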